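import Mathlib
import HarnessLib
import Literature.NumberTheory.LFunctions.ZetaScrew
import Summits.RiemannHypothesis.RiemannHypothesis.Theorems.IntegerScrewRung128
import Summits.RiemannHypothesis.RiemannHypothesis.Theorems.MotivicDoorSemilocalClosed
import Summits.RiemannHypothesis.RiemannHypothesis.Theorems.WeilFormatCDataA1RungCB
import Summits.RiemannHypothesis.RiemannHypothesis.Theorems.IntegerScrewTopBlockNegHead
import Summits.RiemannHypothesis.RiemannHypothesis.Theorems.DbrLatticeAntipersistence
import Summits.RiemannHypothesis.RiemannHypothesis.Theorems.DbrWallLogTableA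

/-!
# W-06 cycle 5, cell C4⁵ (T) «DELETION-UNIFORM TRANSFERS» — the DELETION FLOOR as an RH-free
# transfer into the SCREW column: `S_M(ζ_{ℙ∖S}) ≻ 0` for every finite deleted set `S` and every
# `M ≤ min(min S − 1, 128)` (kernel; rh-idea-6 g14)

The kept system `ζ_{ℙ∖S}` (delete the Euler factors at the primes of a finite set `S`) has screw
function `Ψ_S = Ψ + φ_S` (Suzuki2023 (1.1) with `Λ` replaced by `Λ·[minFac ∉ S]`; `φ_S` = the deleted
hinge sum, rh-idea-6 g13 `Sketch-W06i-sigma4desk` §C, copied verbatim in §1) and screw Gram matrix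
`keptScrewMatrix S n = [Ψ_S(log m) + Ψ_S(log m') − Ψ_S(log(m/m'))]_{2 ≤ m,m' ≤ n+1}`.

TRANSFER (Beurling window → SCREW level), RH-free:
* LOCALITY `keptScrewMatrix_eq_screwMatrix` — if every deleted prime is `≥ n + 1` then
  `keptScrewMatrix S n = screwMatrix n` (the deleted hinge sum vanishes at every node `log m` and every
  difference `log(m/m')`, `m, m' ≤ n+1 ≤ min S`: a deleted power at the top node carries hinge `0`);
* BANKED RUNG `IntegerScrew.screwMatrix_posDef_of_le_127` (`S_M ≻ 0`, `M ≤ 128`, kernel certificate);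
* hence `keptScrewMatrix_posDef` — **for every finite `S ⊂ ℕ` and every `n ≤ 127` with `n + 1 ≤ p` for all
  `p ∈ S`, the kept screw matrix `S_{n+1}(ζ_{ℙ∖S})` is positive definite** — uniformly in `S`; in
  particular (`keptScrewMatrix_posDef_of_forall_ge_128`) the banked SCREW inventory `M ≤ 128` is BLIND
  to every deletion `≥ 128`, and a deletion with least prime `p₁ ≤ 128` can first be seen at
  `M ≥ p₁ + 1` (detection of record: `M₀(ℙ∖{p}) = p + {1,1,1,1,1,1,1,2,2,3}`, `p ≤ 29`, pencil Cholesky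
  rh-idea-6 g13 `pencil_m0.out`; kernel `RhIdea6.G13.Sigma4.keptScrew_two_not_psd` for `p = 2`, `M = 4`).
TRANSFER (Beurling window → WEIL window), RH-free, in the tree's semilocal language (§4): on a window
`a ≤ (log p₁)/2` the kept system's Weil form IS the semilocal form `Q_S` with `S = keptPrimesBelow D (p₁−1)`
(every prime power that can meet the cone `C(a)` is `≤ e^{2a} ≤ p₁`, the boundary one with weight `0`), and
`MotivicDoor.Semilocal.weilSemilocalPositivityOn_iff_weilPositivityOn_of_le` makes its positivity
EQUIVALENT to `WeilPositivityOn a` (`keptWeil_iff_weil`); with the banked rung `weilPositivityOn_one`: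
`keptWeil_of_le_seven` — every deletion with floor `p₁ ≤ 7` is Weil-positive on every window `a ≤ (log p₁)/2`,
and every deletion with floor `p₁ ≥ 8` on every window `a ≤ 1` (`keptWeil_blind_of_banked`).
DETECTION + CALIBRATION (§5, §6): for every finite `D ∋ 2`, `det S_3(ζ_{ℙ∖D}) < 0` (kernel certificate on the
tree's enclosures) — so `M₀(ℙ∖D) = 3 = p₁ + 1`; and the CALIBRATION PIN `uniformWSTransfer_pin_two`: every W→S
transfer uniform over the kept class has `f((log 2)/2) ≤ 2 = e^{2a}` (the tree's `⌊e^{2a}⌋` is sharp there).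
TEST 0: both sides are finite rungs; 0 bits toward `Re ρ(ζ)`. Nothing here bears on the truth of RH.
References: M. Suzuki, J. Lond. Math. Soc. (2) 108 (2023) = arXiv:2206.03682, (1.1), (1.4), Thm 1.2
[Suzuki2023]; H. G. Diamond, H. L. Montgomery, U. Vorhauer, Math. Ann. 334 (2006) (Beurling primes) [folklore].
-/

set_option linter.dupNamespace false

namespace RhIdea6.G14.Transfer

open Literature.NumberTheory.LFunctions Finset
open Summit.RiemannHypothesis.RiemannHypothesis.Theorems.IntegerScrew
open scoped BigOperators

/-! ## §1. Kept screw function (rh-idea-6 g13 §C, verbatim) -/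

/-- The DELETED HINGE SUM `φ_S(t) = ∑_{n ≤ e^{|t|}, minFac n ∈ S} Λ(n) n^{-1/2} (|t| − log n)`. [folklore] -/
noncomputable def deletedHinge (S : Finset ℕ) (t : ℝ) : ℝ :=
  ∑ n ∈ Icc 1 ⌊Real.exp |t|⌋₊,
    if n.minFac ∈ S then (ArithmeticFunction.vonMangoldt n : ℝ) / Real.sqrt n * (|t| - Real.log n)
    else 0

/-- The KEPT SCREW FUNCTION `Ψ_S = Ψ + φ_S`. [cite: Suzuki2023, (1.1) with Λ·[minFac ∉ S]] -/
noncomputable def keptScrew (S : Finset ℕ) (t : ℝ) : ℝ := zetaScrew t + deletedHinge S t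

/-- The KEPT SCREW GRAM MATRIX on the nodes `log 2, …, log(n+1)`:
`Ψ_S(log(i+2)) + Ψ_S(log(j+2)) − Ψ_S(log(i+2) − log(j+2))`. [cite: Suzuki2023, (1.4)] -/
noncomputable def keptScrewMatrix (S : Finset ℕ) (n : ℕ) : Matrix (Fin n) (Fin n) ℝ :=
  Matrix.of fun i j =>
    keptScrew S (Real.log (((i : ℕ) + 2 : ℕ) : ℝ)) + keptScrew S (Real.log (((j : ℕ) + 2 : ℕ) : ℝ))
      - keptScrew S (Real.log (((i : ℕ) + 2 : ℕ) : ℝ) - Real.log (((j : ℕ) + 2 : ℕ) : ℝ))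

/-! ## §2. Locality -/

/-- If every deleted prime is `≥ e^{|t|}`, the deleted hinge sum vanishes at `t` (a deleted power sitting
exactly at `e^{|t|}` carries the hinge `|t| − log n = 0`). [folklore] -/
theorem deletedHinge_eq_zero_of_forall_le {S : Finset ℕ} {t : ℝ}
    (hS : ∀ p ∈ S, Real.exp |t| ≤ p) : deletedHinge S t = 0 := by
  unfold deletedHinge
  refine Finset.sum_eq_zero fun n hn ↦ ?_
  rw [Finset.mem_Icc] at hn
  split_ifs with hmem
  · have h1 := hS _ hmem
    have hle : (n.minFac : ℝ) ≤ n := by exact_mod_cast Nat.minFac_le hn.1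
    have hne : (n : ℝ) ≤ Real.exp |t| := (Nat.le_floor_iff (Real.exp_pos _).le).1 hn.2
    have heq : Real.exp |t| = n := le_antisymm (h1.trans hle) hne
    have ht : |t| = Real.log n := by rw [← heq, Real.log_exp]
    rw [ht, sub_self, mul_zero]
  · rfl

/-- In particular if every deleted prime exceeds `e^{|t|}`. [folklore] -/
theorem deletedHinge_eq_zero_of_forall_lt {S : Finset ℕ} {t : ℝ}
    (hS : ∀ p ∈ S, Real.exp |t| < p) : deletedHinge S t = 0 :=
  deletedHinge_eq_zero_of_forall_le fun p hp ↦ (hS p hp).le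

/-- Hence `Ψ_S(t) = Ψ(t)` whenever every deleted prime is `≥ e^{|t|}`. [folklore] -/
theorem keptScrew_eq_of_forall_le {S : Finset ℕ} {t : ℝ} (hS : ∀ p ∈ S, Real.exp |t| ≤ p) :
    keptScrew S t = zetaScrew t := by
  rw [keptScrew, deletedHinge_eq_zero_of_forall_le hS, add_zero]

/-- Hence `Ψ_S(t) = Ψ(t)` whenever every deleted prime exceeds `e^{|t|}`. [folklore] -/
theorem keptScrew_eq_of_forall_lt {S : Finset ℕ} {t : ℝ} (hS : ∀ p ∈ S, Real.exp |t| < p) :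
    keptScrew S t = zetaScrew t :=
  keptScrew_eq_of_forall_le fun p hp ↦ (hS p hp).le

/-- `e^{|log a − log b|} ≤ max a b` for `a, b ≥ 1`. [folklore] -/
theorem exp_abs_log_sub_log_le {a b : ℝ} (ha : 1 ≤ a) (hb : 1 ≤ b) :
    Real.exp |Real.log a - Real.log b| ≤ max a b := by
  have ha0 : 0 < a := by linarith
  have hb0 : 0 < b := by linarith
  have hla : 0 ≤ Real.log a := Real.log_nonneg ha
  have hlb : 0 ≤ Real.log b := Real.log_nonneg hb
  rcases le_total (Real.log b) (Real.log a) with h | h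
  · rw [abs_of_nonneg (by linarith)]
    calc Real.exp (Real.log a - Real.log b) ≤ Real.exp (Real.log a) :=
          Real.exp_le_exp.2 (by linarith)
      _ = a := Real.exp_log ha0
      _ ≤ max a b := le_max_left _ _
  · rw [abs_of_nonpos (by linarith)]
    calc Real.exp (-(Real.log a - Real.log b)) ≤ Real.exp (Real.log b) :=
          Real.exp_le_exp.2 (by linarith)
      _ = b := Real.exp_log hb0
      _ ≤ max a b := le_max_right _ _

/-- **LOCALITY.** If every deleted prime is `≥ n + 1` (the top node may itself be deleted: its hinge there is
`0`), the kept screw matrix on the nodes `log 2, …, log(n+1)` IS ζ's: `keptScrewMatrix S n = screwMatrix n`. [folklore] -/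
theorem keptScrewMatrix_eq_screwMatrix {S : Finset ℕ} {n : ℕ} (hS : ∀ p ∈ S, n + 1 ≤ p) :
    keptScrewMatrix S n = screwMatrix n := by
  ext i j
  rw [screwMatrix_apply, zetaScrewKernel_def]
  simp only [keptScrewMatrix, Matrix.of_apply]
  have node : ∀ k : Fin n, keptScrew S (Real.log (((k : ℕ) + 2 : ℕ) : ℝ))
      = zetaScrew (Real.log (((k : ℕ) + 2 : ℕ) : ℝ)) := by
    intro k
    apply keptScrew_eq_of_forall_le
    intro p hp
    have hk1 : (1 : ℝ) ≤ (((k : ℕ) + 2 : ℕ) : ℝ) := by exact_mod_cast (by omega : 1 ≤ (k : ℕ) + 2)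
    have hk0 : (0 : ℝ) < (((k : ℕ) + 2 : ℕ) : ℝ) := by linarith
    rw [abs_of_nonneg (Real.log_nonneg hk1), Real.exp_log hk0]
    have : (k : ℕ) + 2 ≤ n + 1 := by omega
    exact_mod_cast this.trans (hS p hp)
  have diff : keptScrew S (Real.log (((i : ℕ) + 2 : ℕ) : ℝ) - Real.log (((j : ℕ) + 2 : ℕ) : ℝ))
      = zetaScrew (Real.log (((i : ℕ) + 2 : ℕ) : ℝ) - Real.log (((j : ℕ) + 2 : ℕ) : ℝ)) := by
    apply keptScrew_eq_of_forall_le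
    intro p hp
    have hi1 : (1 : ℝ) ≤ (((i : ℕ) + 2 : ℕ) : ℝ) := by exact_mod_cast (by omega : 1 ≤ (i : ℕ) + 2)
    have hj1 : (1 : ℝ) ≤ (((j : ℕ) + 2 : ℕ) : ℝ) := by exact_mod_cast (by omega : 1 ≤ (j : ℕ) + 2)
    refine (exp_abs_log_sub_log_le hi1 hj1).trans ?_
    have hi : (((i : ℕ) + 2 : ℕ) : ℝ) ≤ p := by
      have : (i : ℕ) + 2 ≤ n + 1 := by omega
      exact_mod_cast this.trans (hS p hp)
    have hj : (((j : ℕ) + 2 : ℕ) : ℝ) ≤ p := by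
      have : (j : ℕ) + 2 ≤ n + 1 := by omega
      exact_mod_cast this.trans (hS p hp)
    exact max_le hi hj
  rw [node i, node j, diff]

/-! ## §3. The transfer: DELETION FLOOR → SCREW column -/

/-- **DELETION → SCREW TRANSFER (RH-free, uniform in the deleted set).** For every finite `S ⊂ ℕ`
and every `n ≤ 127` with `n + 1 ≤ p` for all `p ∈ S` (level `M = n + 1 ≤ min S`), the kept screw matrix
`S_{n+1}(ζ_{ℙ∖S}) = keptScrewMatrix S n` is positive definite: locality ∘ the banked rung
`screwMatrix_posDef_of_le_127`. So `M₀(ℙ∖S) ≥ min S + 1` whenever `min S ≤ 128`. [folklore] -/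
theorem keptScrewMatrix_posDef {S : Finset ℕ} {n : ℕ} (hn : n ≤ 127)
    (hS : ∀ p ∈ S, n + 1 ≤ p) : (keptScrewMatrix S n).PosDef := by
  rw [keptScrewMatrix_eq_screwMatrix hS]
  exact screwMatrix_posDef_of_le_127 hn

/-- **BLINDNESS OF THE BANKED SCREW INVENTORY.** If every deleted prime exceeds `128`, ALL the banked
screw rungs pass for the kept system: `keptScrewMatrix S n ≻ 0` for every `n ≤ 127`. [folklore] -/
theorem keptScrewMatrix_posDef_of_forall_ge_128 {S : Finset ℕ} (hS : ∀ p ∈ S, 128 ≤ p)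
    {n : ℕ} (hn : n ≤ 127) : (keptScrewMatrix S n).PosDef :=
  keptScrewMatrix_posDef hn fun p hp ↦ le_trans (by omega) (hS p hp)

/-- The same with the deletion floor named: if `p₁ ∈ S` is the least element of `S` (`∀ p ∈ S, p₁ ≤ p`)
then every banked screw rung of level `M = n + 1 ≤ min(p₁, 128)` passes for `ζ_{ℙ∖S}`. [folklore] -/
theorem keptScrewMatrix_posDef_up_to_floor {S : Finset ℕ} {p₁ : ℕ} (hmin : ∀ p ∈ S, p₁ ≤ p)
    {n : ℕ} (hn : n ≤ 127) (hnp : n + 1 ≤ p₁) : (keptScrewMatrix S n).PosDef :=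
  keptScrewMatrix_posDef hn fun p hp ↦ hnp.trans (hmin p hp)

/-! ## §4. The transfer: DELETION FLOOR → WEIL column (tree semilocal language) -/

open Summit.RiemannHypothesis.RiemannHypothesis.Theorems.MotivicDoor.Semilocal
open Summit.RiemannHypothesis.RiemannHypothesis.Theorems.WeilFormatCData.A1

/-- The INCLUDED prime set of the kept system `ζ_{ℙ∖D}` below `N`: the primes `p ≤ N` not in `D`. [folklore] -/
def keptPrimesBelow (D : Finset ℕ) (N : ℕ) : Finset ℕ :=
  ((Finset.range (N + 1)).filter Nat.Prime) \ D

/-- If every deleted prime exceeds `N`, every prime factor of every `n ≤ N` is an included prime. [folklore] -/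
theorem primeFactors_subset_keptPrimesBelow {D : Finset ℕ} {N : ℕ} (hD : ∀ p ∈ D, N < p) :
    ∀ n ≤ N, IsPrimePow n → n.primeFactors ⊆ keptPrimesBelow D N := by
  intro n hn _ q hq
  rw [Nat.mem_primeFactors] at hq
  obtain ⟨hqp, hqn, hn0⟩ := hq
  have hqle : q ≤ N := (Nat.le_of_dvd (Nat.pos_of_ne_zero hn0) hqn).trans hn
  simp only [keptPrimesBelow, Finset.mem_sdiff, Finset.mem_filter, Finset.mem_range]
  exact ⟨⟨by omega, hqp⟩, fun hqD ↦ by have := hD q hqD; omega⟩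

/-- **DELETION → WEIL TRANSFER (window identity, RH-free, uniform in the deleted set).** If every deleted
prime exceeds `N` then on every window `a ≤ (log(N+1))/2` the kept system's (semilocal) Weil positivity is
EQUIVALENT to ζ's `WeilPositivityOn a`. [cite: ConnesConsani2023, §2.1.2 (only the primes p < λ² enter QW_λ)] -/
theorem keptWeil_iff_weil {D : Finset ℕ} {N : ℕ} (hD : ∀ p ∈ D, N < p) {a : ℝ}
    (ha : a ≤ Real.log ((N : ℝ) + 1) / 2) :
    WeilSemilocalPositivityOn (keptPrimesBelow D N) a ↔ WeilPositivityOn a :=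
  weilSemilocalPositivityOn_iff_weilPositivityOn_of_le (primeFactors_subset_keptPrimesBelow hD) ha

/-- **DELETION FLOOR `p₁ ≤ 7` ⟹ kept Weil positivity up to the floor window (RH-free):** if every deleted
prime exceeds `N` and `N ≤ 6` then the kept system is Weil-positive on every window `a ≤ (log(N+1))/2`
(banked rung `weilPositivityOn_one`, `(log 7)/2 < 1`). Take `N = p₁ − 1`. [folklore] -/
theorem keptWeil_of_le_seven {D : Finset ℕ} {N : ℕ} (hD : ∀ p ∈ D, N < p) (hN : N ≤ 6) {a : ℝ}
    (ha : a ≤ Real.log ((N : ℝ) + 1) / 2) :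
    WeilSemilocalPositivityOn (keptPrimesBelow D N) a := by
  refine (keptWeil_iff_weil hD ha).2 (WeilPositivityOn.mono (ha.trans ?_) weilPositivityOn_one)
  have hN7 : (N : ℝ) + 1 ≤ 7 := by exact_mod_cast (show N + 1 ≤ 7 by omega)
  have hpos : (0 : ℝ) < (N : ℝ) + 1 := by positivity
  have := Real.log_le_log hpos hN7
  have hl7 : Real.log 7 < 2 := by
    rw [Real.log_lt_iff_lt_exp (by norm_num)]
    have h1 : (2.7182818283 : ℝ) < Real.exp 1 := Real.exp_one_gt_d9
    have h2 : Real.exp 2 = Real.exp 1 * Real.exp 1 := by rw [← Real.exp_add]; norm_num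
    rw [h2]; nlinarith
  linarith

/-- **BLINDNESS OF THE BANKED WEIL INVENTORY:** a deletion whose floor exceeds `7` (every deleted prime
`≥ 8`, so `> 7 ≥ e^{2a}` for `a ≤ (log 8)/2 ≥ 1`) passes the whole banked Weil rung `a ≤ 1`. [folklore] -/
theorem keptWeil_blind_of_banked {D : Finset ℕ} (hD : ∀ p ∈ D, 7 < p) {a : ℝ} (ha : a ≤ 1) :
    WeilSemilocalPositivityOn (keptPrimesBelow D 7) a := by
  have ha' : a ≤ Real.log ((7 : ℕ) + 1 : ℝ) / 2 := by
    have h8 : (2 : ℝ) ≤ Real.log 8 := by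
      rw [Real.le_log_iff_exp_le (by norm_num)]
      have h1 : Real.exp 1 < 2.7182818286 := Real.exp_one_lt_d9
      have h2 : Real.exp 2 = Real.exp 1 * Real.exp 1 := by rw [← Real.exp_add]; norm_num
      rw [h2]; nlinarith [Real.exp_pos 1]
    push_cast; linarith
  exact (keptWeil_iff_weil hD ha').2 (WeilPositivityOn.mono ha weilPositivityOn_one)

end RhIdea6.G14.Transfer
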